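/-
Origin: expansion seat `planner-pub-hodgecm-mc-axioms-1-g14-0`, handover #W18 2026-08-20T15:53:55Z md5 360da1242c96 (PKG 48f28725c643 → 360da1242c96; 86 l.; MECHANICAL (iib-R) rewrite v3.1 of the PKG file as it stands (7 token edits; rules R1x1+RX[h₂]x6)) (`HOME/mc/pub-hodgecm-mc-axioms-1-g14/revendor/kit-r55/stage55/HodgeCM/Model/GoodSexticWitness.lean`, md5 360da1242c96, 86 lines);
landed by the gen-22 packager (p-g22) in gate run 55 REPLACES the earlier landed copy of `HodgeCM/Model/GoodSexticWitness.lean` (seat copy carried the packager Origin header of an earlier run (stripped)).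
-/
/-
Copyright: pub-hodgecm formalisation cell (harness21, 2026). New file (not vendored).
Origin: KEPT seat "PerL residual" / END-STATE owner `planner-pub-hodgecm-prl1-g15-0` (unit pub-hodgecm-prl1-g15, gen 15),
2026-08-19.  NEW additive KERNEL leaf `HodgeCM/Model/GoodSexticWitness.lean` (RUN 34+ material): imports only the INSTALLED
modules `HodgeCM.Model.E2Instance` (the END STATE's theta model `thetaModelOf`) and `HodgeCM.Model.PerLInhabited`
(gate run 22, `HodgeCM.perLHypothesesInhabited`); nothing imports it.  Install anywhere after those two.
KERNEL: 0 records, 0 `Prop` definitions, 0 hypotheses minted, nothing cited, no instances; axioms = the Lean trio.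
-/
import Summits.HodgeConjecture.HodgeCM.Model.E2Instance
import Summits.HodgeConjecture.HodgeCM.Model.PerLInhabited

/-!
# The END STATE's theta model admits an anisotropic GOOD SEXTIC context (non-vacuity certificate for E's guards)

Answer of the END-STATE chair to the SANITY lane's node SAN-15 (`HodgeCM/Model/Sanity/DegenerateClosure.lean`,
question (ii) there: "is `NoGoodSextic` refutable inside PKG?").  YES, from INSTALLED theorems only, for ARBITRARY
data `(emb, cover, wm, Theta, d12, d34)` of the END STATE's model — because every guard `GoodCtx ι₁ c` of
`Model.thetaModelOf …` reads the model only through its sign recipe (`kappa = SignRecipe.kappa h`,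
`frameSign = SignRecipe.frameSign`, both `rfl`):

* `HodgeCM.perLHypothesesInhabited` (Model/PerLInhabited): a sextic CM field `K`, a normal closure `L` with
  `[L:ℚ] ∈ {24, 48}`, `j : K →+* L`, a frame `φ`, `ι₁` extending `φ 0`, and PerL types `t` (`IsPerLTypes φ t`);
* `StubTree.pairSum_of_isPerLTypes` / `StubTree.injective_of_isPerLTypes` (StubTree/Combinatorics) and
  `ThetaModel.exists_seesawDatum_constructed` (Proofs/SeesawConstruction) under the two design constraints, which are
  THEOREMS for a model carrying PerL's recipe (`ThetaModel.design_kappaConj_of_eq`, `design_frameSignConj_of_eq`,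
  Automorphic/SignRecipe) — exactly the context construction of `Model.EndStateMeet.realisationExistsPerL₂_of_pt`;
* `StubTree.landherr_exists` (a `HermSpace3 L ι₁` exists) and `HermSpace3.isAnisotropic` (Automorphic/AdelicUnitaryModel:
  anisotropic as soon as `4 ≤ [L:ℚ]`).

Hence (`not_noGoodSextic₀`) the VACUITY RESIDUAL of SAN-15 is FALSE in kernel for every choice of data, in particular
at the degenerate data `S := degS`, `W := zeroSK ∘ W`: combined with SAN-15's `nonempty_CdegS_iff_noGoodSextic` this
gives `IsEmpty (CdegS …)` — the toy closure `perL_r13core_degS` has an EMPTY hypothesis type, i.e. the pin socket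
`C` of `Model.perL_picardCM_r13` (and, at honest `S`, the binders `hT hpd hk` of R15 and the `Prop` fields of the v2
`ThetaAdelicSide`) is where the E term is genuinely load-bearing.  (The one-line combination is left to the SANITY
lane's next leaf, which imports both files; this file does not import `Sanity/DegenerateClosure`.)
-/

noncomputable section

namespace HodgeCM
namespace Model

open HodgeCM.Universe (SideData ThetaModel)
open Literature.AlgebraicGeometry.HodgeTheory
open Literature.NumberTheory.Automorphic.PicardCM

variable (hHD : exists_isReal_hodgeModel) (hI : hodgePQ_independent_of_hodgeModel)
  (h₁ : BallQuotientUniformised)  (h₃ : CMAbelianVarietyRealised)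

/-- **The END STATE's theta model admits an anisotropic good sextic context**, for ANY data
`(emb, cover, wm, Theta, d12, d34)`: the witness is PerL's own hypothesis class (`perLHypothesesInhabited`:
`K = ℚ(i√(2-α₀))`, `α₀³ - 4α₀ + 1 = 0`), Landherr's hermitian space over its normal closure, and the seesaw datum
constructed from PerL's sign recipe. -/
theorem exists_anisotropic_goodSextic (h : Bool) (emb) (cover) (wm) (Theta)
    (d12 d34 : ∀ {L : CMField}, SeesawCtx L → SideData L) :
    ∃ (L : CMField) (ι₁ : L →+* ℂ) (V : HermSpace3 L ι₁) (c : SeesawCtx L),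
      IsAnisotropic L V.Hm ∧ (thetaModelOf hHD hI h₁ h₃ h emb cover wm Theta d12 d34).GoodCtx ι₁ c ∧
        Module.finrank ℚ c.K = 6 := by
  obtain ⟨K, L, j, _hN, hK, hL, φ, hφ, ι₁, hι₁, t, ht⟩ := HodgeCM.perLHypothesesInhabited
  have hκ := (thetaModelOf hHD hI h₁ h₃ h emb cover wm Theta d12 d34).design_kappaConj_of_eq h rfl
  have hs := (thetaModelOf hHD hI h₁ h₃ h emb cover wm Theta d12 d34).design_frameSignConj_of_eq rfl
  have hΨ : PairSum t := StubTree.pairSum_of_isPerLTypes K φ hφ hK t ht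
  obtain ⟨D, hD⟩ :=
    (thetaModelOf hHD hI h₁ h₃ h emb cover wm Theta d12 d34).exists_seesawDatum_constructed hκ hs j ι₁ t hΨ
  obtain ⟨V⟩ := StubTree.landherr_exists L ι₁
  have h4 : 4 ≤ Module.finrank ℚ L := by rcases hL with hL | hL <;> omega
  exact ⟨L, ι₁, V, ⟨K, t, φ 0, D⟩, V.isAnisotropic h4,
    ⟨hΨ, StubTree.injective_of_isPerLTypes K φ hφ t ht, fun i => (ht i 0).mpr (by fin_cases i <;> rfl),
      ⟨j, hι₁, hD⟩⟩, hK⟩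

/-- **No "no good sextic context" for the END STATE's model** (the negation of the SANITY lane's vacuity residual
`Sanity.NoGoodSextic`, in its exact binder shape, for ANY data): anisotropic good contexts of sextic `K` exist. -/
theorem not_noGoodSextic₀ (h : Bool) (emb) (cover) (wm) (Theta)
    (d12 d34 : ∀ {L : CMField}, SeesawCtx L → SideData L) :
    ¬ (∀ {L : CMField} {ι₁ : L →+* ℂ} (V : HermSpace3 L ι₁) (c : SeesawCtx L), IsAnisotropic L V.Hm →
        (thetaModelOf hHD hI h₁ h₃ h emb cover wm Theta d12 d34).GoodCtx ι₁ c → Module.finrank ℚ c.K ≠ 6) := by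
  intro hno
  obtain ⟨L, ι₁, V, c, hV, hc, h6⟩ := exists_anisotropic_goodSextic hHD hI h₁ h₃ h emb cover wm Theta d12 d34
  exact hno V c hV hc h6

end Model
end HodgeCM
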